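import Literature.AlgebraicGeometry.Frobenioids.DivisorMonoidCategoryTheoreticityCorProofsV
import Literature.AlgebraicGeometry.Frobenioids.UnitTrivialisationFunctoriality
import Literature.AlgebraicGeometry.Frobenioids.BaseSquareComposition
import Literature.AlgebraicGeometry.Frobenioids.BirationalizationBiratData
import Mathlib.CategoryTheory.ObjectProperty.Equivalence
import HarnessLib

/-!
# Frobenioids I, Corollary 4.11 (ii) — ASSEMBLY of the birational tower
# `C_i → C_i^birat → (C_i^birat)^un-tr → D_i` from its pieces

Mochizuki, *The geometry of Frobenioids I: the general theory*, Kyushu J. Math. **62** (2008)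
293–400, kurims text proof of Cor. 4.11 (ii) p. 93 l. 30 – p. 94 l. 8 [cite: MochizukiFrdI2008, Cor. 4.11 (ii) p.93].

PROOF-ONLY (cell sub-DAG S2, sub-nodes L09–L17). For Frobenioids `C_i → F_{Φ_i}` with THE
birationalizations `C_i^birat` (`PreFrobenioid.Birat`, `toBirat`, operations `biratOps` over `0_{D_i}`; seats
abc-iut-L6-t8 / L6-t6) of ISOTROPIC type, this file assembles the base square of `Ψ` — hence the typed
Cor. 4.11 (ii) (`cor411ii_of_exists_base_equivalence'`) — from the printed pieces, taken as hypotheses in the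
shapes of their sub-nodes:
* (L09) an equivalence `Ψ^birat : C₁^birat ⥲ C₂^birat` over `Ψ` (in the tree: `PreFrobenioid.mapOfEquiv`,
  `mapOfEquivFac`, `mapOfEquiv_isEquivalence`, Cor. 4.10 — seat abc-iut-L1-t10);
* (L11) `Ψ^birat`, `(Ψ^birat)⁻¹` preserve `O^×(−)` (p. 93 ll. 36–46; seat abc-iut-L1-d4);
* (L13) operations `SU_i` on `(C_i^birat)^un-tr` over `D_i` whose base factors that of `C_i^birat`
  (seat abc-iut-L1-d5: `untrFunctor`) and, for the induced `(Ψ^birat)^un-tr`, a `1`-unique base square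
  (Prop. 3.11 (iii), seat abc-iut-L1-t13);
the steps L12 (`(Ψ^birat)^un-tr` via `exists_untr_oneUniqueSquare`), L14 ("composing diagrams"), L15/L16
(`1`-uniqueness, rigidity) being kernel-checked here and in `BaseSquareComposition` / `…CorProofsV`.

* `exists_base_equivalence_of_birat_pieces`: the base square; `cor411ii_of_birat_pieces`: the typed Cor. 4.11 (ii).

No statement of the paper is strengthened; nothing here is specific to the abc programme.
-/

namespace Literature.AlgebraicGeometry.Frobenioids

open CategoryTheory Opposite

universe w v v' u u'

namespace PreFrobenioid

variable {D₁ : Type u} [Category.{v} D₁] {Φ₁ : D₁ᵒᵖ ⥤ CommMonCat.{w}}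
  {C₁ : Type u'} [Category.{v'} C₁] {F₁ : C₁ ⥤ ElemFrobenioid Φ₁}
  {D₂ : Type u} [Category.{v} D₂] {Φ₂ : D₂ᵒᵖ ⥤ CommMonCat.{w}}
  {C₂ : Type u'} [Category.{v'} C₂] {F₂ : C₂ ⥤ ElemFrobenioid Φ₂}

/-- **The base square of `Ψ` from the birational tower** (FrdI proof of Cor. 4.11 (ii), p. 93 l. 30 –
p. 94 l. 7): given the birationalizations `C_i^birat` of isotropic type, an equivalence
`Ψ^birat : C₁^birat ⥲ C₂^birat` with `Ψ^birat ∘ (C₁ → C₁^birat) ≅ (C₂ → C₂^birat) ∘ Ψ` such that `Ψ^birat` and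
its quasi-inverse preserve `O^×(−)`, operations `SU_i` on `(C_i^birat)^un-tr` whose base factors that of
`C_i^birat`, and — for every `(Ψ^birat)^un-tr` `1`-commuting with `Ψ^birat` over the projections — a `1`-unique
base square (Prop. 3.11 (iii)), there is an equivalence `Ψ^Base : D₁ ⥲ D₂` with `Base₂ ∘ Ψ ≅ Ψ^Base ∘ Base₁`.
[cite: MochizukiFrdI2008, Cor. 4.11 (ii) p.93] -/
theorem exists_base_equivalence_of_birat_pieces (hF₁ : IsFrobenioid F₁) (hsq₁ : HasBiratSquares F₁)
    (hF₂ : IsFrobenioid F₂) (hsq₂ : HasBiratSquares F₂) (Ψ : C₁ ≌ C₂)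
    (hiso₁ : (biratOps hF₁ hsq₁).IsOfIsotropicType) (hiso₂ : (biratOps hF₂ hsq₂).IsOfIsotropicType)
    (Eb : Birat F₁ hF₁ hsq₁ ≌ Birat F₂ hF₂ hsq₂)
    (sq : toBirat F₁ hF₁ hsq₁ ⋙ Eb.functor ≅ Ψ.functor ⋙ toBirat F₂ hF₂ hsq₂)
    (hunits : ∀ (X : Birat F₁ hF₁ hsq₁) (u : Aut X), u ∈ (biratOps hF₁ hsq₁).unitsSubgroup X →
      Eb.functor.mapIso u ∈ (biratOps hF₂ hsq₂).unitsSubgroup (Eb.functor.obj X))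
    (hunits' : ∀ (Y : Birat F₂ hF₂ hsq₂) (u : Aut Y), u ∈ (biratOps hF₂ hsq₂).unitsSubgroup Y →
      Eb.inverse.mapIso u ∈ (biratOps hF₁ hsq₁).unitsSubgroup (Eb.inverse.obj Y))
    (SU₁ : PreFrobenioidData.{w} (biratOps hF₁ hsq₁).Untr D₁)
    (SU₂ : PreFrobenioidData.{w} (biratOps hF₂ hsq₂).Untr D₂)
    (ιU₁ : (biratOps hF₁ hsq₁).toUntr ⋙ SU₁.base ≅ (biratOps hF₁ hsq₁).istrι ⋙ (biratOps hF₁ hsq₁).base)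
    (ιU₂ : (biratOps hF₂ hsq₂).toUntr ⋙ SU₂.base ≅ (biratOps hF₂ hsq₂).istrι ⋙ (biratOps hF₂ hsq₂).base)
    (hU : ∀ (G : (biratOps hF₁ hsq₁).Istr ≌ (biratOps hF₂ hsq₂).Istr)
      (ΨU : (biratOps hF₁ hsq₁).Untr ⥤ (biratOps hF₂ hsq₂).Untr),
      ΨU.IsEquivalence → OneCommutes G.functor (biratOps hF₂ hsq₂).toUntr (biratOps hF₁ hsq₁).toUntr ΨU →
        ∃ ΨBase : D₁ ⥤ D₂, ΨBase.IsEquivalence ∧ OneCommutes ΨU SU₂.base SU₁.base ΨBase) :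
    ∃ ΨBase : D₁ ⥤ D₂, ΨBase.IsEquivalence ∧
      OneCommutes Ψ.functor (PreFrobenioidData.ofFunctor Φ₂ F₂).base (PreFrobenioidData.ofFunctor Φ₁ F₁).base ΨBase := by
  -- the isotropic objects of `C_i^birat` are all objects
  let P := (biratOps hF₁ hsq₁).isotropicObjects
  let Q := (biratOps hF₂ hsq₂).isotropicObjects
  haveI : Q.IsClosedUnderIsomorphisms := ⟨fun _ _ => hiso₂.obj _⟩
  have hPQ : Q.inverseImage Eb.functor = P := by
    funext X
    exact propext ⟨fun _ => hiso₁.obj X, fun _ => hiso₂.obj _⟩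
  -- `Ψ^birat` on the isotropic objects (L12, first half)
  let G : (biratOps hF₁ hsq₁).Istr ≌ (biratOps hF₂ hsq₂).Istr := Eb.congrFullSubcategory hPQ
  have hG := PreFrobenioidData.unitEquiv_map_of_units _ _ G.functor fun X δ hδ =>
    ⟨Eb.functor.mapIso δ, hunits X.obj δ hδ, rfl⟩
  have hG' := PreFrobenioidData.unitEquiv_map_of_units _ _ G.inverse fun Y δ hδ =>
    ⟨Eb.inverse.mapIso δ, hunits' Y.obj δ hδ, rfl⟩
  -- `(Ψ^birat)^un-tr` (L12, second half) and its base square (L13)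
  obtain ⟨ΨU, hEqU, hsqU, -⟩ := PreFrobenioidData.exists_untr_oneUniqueSquare _ _ G hG hG'
  haveI := hEqU
  obtain ⟨ΨBase, hEqB, hsqB⟩ := hU G ΨU hEqU hsqU
  refine ⟨ΨBase, hEqB, ?_⟩
  -- the functors `C_i → C_i^birat → (C_i^birat)^istr → (C_i^birat)^un-tr`
  let L₁ : C₁ ⥤ (biratOps hF₁ hsq₁).Istr := P.lift (toBirat F₁ hF₁ hsq₁) fun A => hiso₁.obj _
  let L₂ : C₂ ⥤ (biratOps hF₂ hsq₂).Istr := Q.lift (toBirat F₂ hF₂ hsq₂) fun A => hiso₂.obj _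
  -- `Base_i` factors through `C_i → (C_i^birat)^un-tr`
  have ι₁ : (L₁ ⋙ (biratOps hF₁ hsq₁).toUntr) ⋙ SU₁.base ≅ (PreFrobenioidData.ofFunctor Φ₁ F₁).base :=
    Functor.associator _ _ _ ≪≫ Functor.isoWhiskerLeft L₁ ιU₁ ≪≫ (Functor.associator _ _ _).symm ≪≫
      Functor.isoWhiskerRight (P.liftCompιIso _ _) _ ≪≫ biratOverBase hF₁ hsq₁
  have ι₂ : (L₂ ⋙ (biratOps hF₂ hsq₂).toUntr) ⋙ SU₂.base ≅ (PreFrobenioidData.ofFunctor Φ₂ F₂).base :=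
    Functor.associator _ _ _ ≪≫ Functor.isoWhiskerLeft L₂ ιU₂ ≪≫ (Functor.associator _ _ _).symm ≪≫
      Functor.isoWhiskerRight (Q.liftCompιIso _ _) _ ≪≫ biratOverBase hF₂ hsq₂
  -- `Ψ` over `C_i → (C_i^birat)^istr`: the square `sq` lifted to the full subcategories
  have sqI : L₁ ⋙ G.functor ≅ Ψ.functor ⋙ L₂ :=
    (Q.fullyFaithfulι.whiskeringRight C₁).preimageIso sq
  -- `Ψ` over `C_i → (C_i^birat)^un-tr`
  obtain ⟨τ⟩ := hsqU
  have hT : OneCommutes Ψ.functor (L₂ ⋙ (biratOps hF₂ hsq₂).toUntr) (L₁ ⋙ (biratOps hF₁ hsq₁).toUntr) ΨU :=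
    ⟨(Functor.associator _ _ _).symm ≪≫ Functor.isoWhiskerRight sqI.symm _ ≪≫ Functor.associator _ _ _ ≪≫
      Functor.isoWhiskerLeft L₁ τ ≪≫ (Functor.associator _ _ _).symm⟩
  exact PreFrobenioidData.oneCommutes_base_of_tower _ _ Ψ SU₁ SU₂ _ _ ι₁ ι₂ ΨU hT ΨBase hsqB

/-- **Corollary 4.11 (ii) from the birational pieces** (FrdI pp. 93–94): under the hypotheses of
`exists_base_equivalence_of_birat_pieces`, the typed Cor. 4.11 (ii) holds for `Ψ` (`1`-uniqueness and
rigidity for slim bases being automatic for Frobenioids, `cor411ii_of_exists_base_equivalence'`).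
[cite: MochizukiFrdI2008, Cor. 4.11 (ii) p.91] -/
theorem cor411ii_of_birat_pieces (hF₁ : IsFrobenioid F₁) (hsq₁ : HasBiratSquares F₁)
    (hF₂ : IsFrobenioid F₂) (hsq₂ : HasBiratSquares F₂) (Ψ : C₁ ≌ C₂)
    (hiso₁ : (biratOps hF₁ hsq₁).IsOfIsotropicType) (hiso₂ : (biratOps hF₂ hsq₂).IsOfIsotropicType)
    (Eb : Birat F₁ hF₁ hsq₁ ≌ Birat F₂ hF₂ hsq₂)
    (sq : toBirat F₁ hF₁ hsq₁ ⋙ Eb.functor ≅ Ψ.functor ⋙ toBirat F₂ hF₂ hsq₂)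
    (hunits : ∀ (X : Birat F₁ hF₁ hsq₁) (u : Aut X), u ∈ (biratOps hF₁ hsq₁).unitsSubgroup X →
      Eb.functor.mapIso u ∈ (biratOps hF₂ hsq₂).unitsSubgroup (Eb.functor.obj X))
    (hunits' : ∀ (Y : Birat F₂ hF₂ hsq₂) (u : Aut Y), u ∈ (biratOps hF₂ hsq₂).unitsSubgroup Y →
      Eb.inverse.mapIso u ∈ (biratOps hF₁ hsq₁).unitsSubgroup (Eb.inverse.obj Y))
    (SU₁ : PreFrobenioidData.{w} (biratOps hF₁ hsq₁).Untr D₁)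
    (SU₂ : PreFrobenioidData.{w} (biratOps hF₂ hsq₂).Untr D₂)
    (ιU₁ : (biratOps hF₁ hsq₁).toUntr ⋙ SU₁.base ≅ (biratOps hF₁ hsq₁).istrι ⋙ (biratOps hF₁ hsq₁).base)
    (ιU₂ : (biratOps hF₂ hsq₂).toUntr ⋙ SU₂.base ≅ (biratOps hF₂ hsq₂).istrι ⋙ (biratOps hF₂ hsq₂).base)
    (hU : ∀ (G : (biratOps hF₁ hsq₁).Istr ≌ (biratOps hF₂ hsq₂).Istr)
      (ΨU : (biratOps hF₁ hsq₁).Untr ⥤ (biratOps hF₂ hsq₂).Untr),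
      ΨU.IsEquivalence → OneCommutes G.functor (biratOps hF₂ hsq₂).toUntr (biratOps hF₁ hsq₁).toUntr ΨU →
        ∃ ΨBase : D₁ ⥤ D₂, ΨBase.IsEquivalence ∧ OneCommutes ΨU SU₂.base SU₁.base ΨBase) :
    (PreFrobenioidData.ofFunctor Φ₁ F₁).Cor411ii (PreFrobenioidData.ofFunctor Φ₂ F₂) Ψ :=
  cor411ii_of_exists_base_equivalence' F₁ F₂ Ψ hF₁ hF₂
    (exists_base_equivalence_of_birat_pieces hF₁ hsq₁ hF₂ hsq₂ Ψ hiso₁ hiso₂ Eb sq hunits hunits' SU₁ SU₂ ιU₁ ιU₂ hU)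

end PreFrobenioid

end Literature.AlgebraicGeometry.Frobenioids
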